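import Literature.AnabelianGeometry.SemiGraphs.OrbitGraph

/-!
# Functoriality of the underlying semi-graph of a covering ([SemiAnbd] §3 p. 37)

Sequel to `OrbitGraph.lean`.  A morphism `f : T ⟶ S` of `B^cov(𝒢)` (equivariant maps of fibres
compatible with the gluings) maps orbits to orbits and commutes with the gluings, hence induces a
morphism of underlying semi-graphs `f̄ : 𝔾_T → 𝔾_S` over `𝔾` ([SemiAnbd] §3 p. 37: the
assignment `S ↦ (𝒢_S → 𝒢)` is natural; used on p. 38 for the compatible maps
`𝒢_{∞,j} → 𝒢_{∞,i}` between the coverings attached to a cofinal system).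

Main definitions: `CovObj.OVertex.map`, `CovObj.OEdge.map`, `CovObj.orbitGraphMap f`, and
`orbitGraphMap_comp_proj : orbitGraphMap f ≫ S.orbitGraphProj = T.orbitGraphProj`.
-/

namespace Literature.AnabelianGeometry.SemiGraphs

namespace ProfiniteSemiGraph

open CategoryTheory

universe u

variable {𝒢 : ProfiniteSemiGraph.{u}} {T S : CovObj 𝒢} (f : T ⟶ S)

/-- Equivariance of the vertex components of a morphism of `B^cov(𝒢)`: `f (g · x) = g · f x`.
[cite: MochizukiSemiAnbd2006, Def 3.5(i) p.37] -/
theorem CovHom.fV_ρ (v : 𝒢.graph.Vertex) (g : 𝒢.Gv v) (x : (T.SV v).obj.V) :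
    (f.fV v).hom.hom ((T.SV v).obj.ρ g x) = (S.SV v).obj.ρ g ((f.fV v).hom.hom x) :=
  ConcreteCategory.congr_hom ((f.fV v).hom.comm g) x

/-- Equivariance of the edge components. [cite: MochizukiSemiAnbd2006, Def 3.5(i) p.37] -/
theorem CovHom.fE_ρ (e : 𝒢.graph.Edge) (g : 𝒢.Ge e) (y : (T.SE e).obj.V) :
    (f.fE e).hom.hom ((T.SE e).obj.ρ g y) = (S.SE e).obj.ρ g ((f.fE e).hom.hom y) :=
  ConcreteCategory.congr_hom ((f.fE e).hom.comm g) y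

/-- Compatibility with the gluings, pointwise: `glue_S (f y) = f (glue_T y)`.
[cite: MochizukiSemiAnbd2006, Def 3.5(i) p.37] -/
theorem CovHom.glue_fE (b : 𝒢.graph.Branch) (v : 𝒢.graph.Vertex) (h : 𝒢.graph.abuts b = some v)
    (y : (T.SE (𝒢.graph.edgeOf b)).obj.V) :
    (S.glue b v h).hom.hom.hom ((f.fE (𝒢.graph.edgeOf b)).hom.hom y) =
      (f.fV v).hom.hom ((T.glue b v h).hom.hom.hom y) :=
  ConcreteCategory.congr_hom (congrArg
    (fun φ : T.SE (𝒢.graph.edgeOf b) ⟶ (BTemp.res (𝒢.brHom b v h)).obj (S.SV v) => φ.hom.hom)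
    (f.comm b v h)) y

/-- The map on vertex-orbits induced by a morphism of coverings. [cite: MochizukiSemiAnbd2006, Def 3.5(i) p.37] -/
def CovObj.OVertex.map : T.OVertex → S.OVertex :=
  Quot.map (fun p => ⟨p.1, (f.fV p.1).hom.hom p.2⟩) (by
    rintro _ _ ⟨v, g, x⟩
    rw [CovHom.fV_ρ]
    exact CovObj.VRel.mk v g _)

/-- The map on edge-orbits induced by a morphism of coverings. [cite: MochizukiSemiAnbd2006, Def 3.5(i) p.37] -/
def CovObj.OEdge.map : T.OEdge → S.OEdge :=
  Quot.map (fun p => ⟨p.1, (f.fE p.1).hom.hom p.2⟩) (by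
    rintro _ _ ⟨e, g, y⟩
    rw [CovHom.fE_ρ]
    exact CovObj.ERel.mk e g _)

/-- `OVertex.map` preserves the base vertex. [cite: MochizukiSemiAnbd2006, Def 3.5(i) p.37] -/
theorem CovObj.OVertex.base_map (V : T.OVertex) :
    CovObj.OVertex.base S (CovObj.OVertex.map f V) = CovObj.OVertex.base T V := by
  induction V using Quot.ind with
  | mk p => rfl

/-- `OEdge.map` preserves the base edge. [cite: MochizukiSemiAnbd2006, Def 3.5(i) p.37] -/
theorem CovObj.OEdge.base_map (E : T.OEdge) :
    CovObj.OEdge.base S (CovObj.OEdge.map f E) = CovObj.OEdge.base T E := by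
  induction E using Quot.ind with
  | mk p => rfl

/-- `glueOpt` commutes with the induced maps on orbits. [cite: MochizukiSemiAnbd2006, Def 3.5(i) p.37] -/
theorem CovObj.glueOpt_map (b : 𝒢.graph.Branch) (v : 𝒢.graph.Vertex)
    (h : 𝒢.graph.abuts b = some v) (E : T.OEdge) :
    S.glueOpt b v h (CovObj.OEdge.map f E) = (T.glueOpt b v h E).map (CovObj.OVertex.map f) := by
  induction E using Quot.ind with
  | mk p =>
    obtain ⟨e, y⟩ := p
    by_cases he : e = 𝒢.graph.edgeOf b
    · subst he
      change S.glueOpt b v h (Quot.mk _ ⟨𝒢.graph.edgeOf b, (f.fE _).hom.hom y⟩) =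
        (T.glueOpt b v h (Quot.mk _ ⟨𝒢.graph.edgeOf b, y⟩)).map _
      rw [S.glueOpt_mk, T.glueOpt_mk]
      exact congrArg (fun z => some (Quot.mk _ (⟨v, z⟩ : Σ v, (S.SV v).obj.V)))
        (CovHom.glue_fE f b v h y)
    · have h1 : S.glueOpt b v h (Quot.mk _ ⟨e, (f.fE e).hom.hom y⟩) = none := dif_neg he
      have h2 : T.glueOpt b v h (Quot.mk _ ⟨e, y⟩) = none := dif_neg he
      change S.glueOpt b v h (Quot.mk _ ⟨e, (f.fE e).hom.hom y⟩) =
        (T.glueOpt b v h (Quot.mk _ ⟨e, y⟩)).map _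
      rw [h1, h2]
      rfl

/-- **The morphism of underlying semi-graphs `𝔾_T → 𝔾_S` induced by a morphism `T ⟶ S` of
coverings.** [cite: MochizukiSemiAnbd2006, Def 3.5(i) p.37] -/
noncomputable def CovObj.orbitGraphMap : T.orbitGraph ⟶ S.orbitGraph where
  vertexMap := CovObj.OVertex.map f
  edgeMap := CovObj.OEdge.map f
  branchMap := fun p => ⟨(p.1.1, CovObj.OEdge.map f p.1.2),
    (CovObj.OEdge.base_map f p.1.2).trans p.2⟩
  edgeOf_branchMap := fun _ => rfl
  branchMap_injOn := by
    rintro ⟨⟨b₁, E₁⟩, h₁⟩ ⟨⟨b₂, E₂⟩, h₂⟩ (hE : E₁ = E₂) hb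
    subst hE
    have hb' : b₁ = b₂ := congrArg (fun q : {p : 𝒢.graph.Branch × S.OEdge //
      CovObj.OEdge.base S p.2 = 𝒢.graph.edgeOf p.1} => q.1.1) hb
    subst hb'
    rfl
  abuts_branchMap := by
    rintro ⟨⟨b, E⟩, hE⟩ V hV
    rcases hab : 𝒢.graph.abuts b with _ | v
    · rw [T.orbitGraph_abuts_of_none b E hE hab] at hV
      exact absurd hV (by simp)
    · rw [T.orbitGraph_abuts_of_abuts b E hE v hab] at hV
      change S.orbitGraph.abuts ⟨(b, CovObj.OEdge.map f E), _⟩ = some (CovObj.OVertex.map f V)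
      rw [S.orbitGraph_abuts_of_abuts b _ _ v hab, CovObj.glueOpt_map, hV]
      rfl

/-- The induced morphism of underlying semi-graphs lies over `𝔾`.
[cite: MochizukiSemiAnbd2006, Def 3.5(i) p.37] -/
theorem CovObj.orbitGraphMap_comp_proj :
    CovObj.orbitGraphMap f ≫ S.orbitGraphProj = T.orbitGraphProj := by
  refine SemiGraph.hom_ext _ _ (funext fun V => ?_) (funext fun E => ?_) (funext fun p => ?_)
  · exact CovObj.OVertex.base_map f V
  · exact CovObj.OEdge.base_map f E
  · rfl

end ProfiniteSemiGraph

end Literature.AnabelianGeometry.SemiGraphs
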